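import Summits.QuantumFields.YangMills.Theorems.ForcedResponseSkewnessResponseLocalisationCentredOscToolkit
import HarnessLib

/-!
# Route `ForcedResponseSkewness`, crux `ResponseLocalisation` (rev 6, stmt-QuantumFields-26871), line
# «signed-femto-collar»: the AF stub `SymNearCovLaw` from the frozen-boundary law and a CENTRED, REFERENCE-FREE
# oscillation law

Helper file (`--supports stmt-QuantumFields-26871`) of the lead prover `ym-line-frs-p1` (g5); the reduction announced in
the toolkit `ForcedResponseSkewnessResponseLocalisationCentredOscToolkit.lean` (same namespace).  The registered physics
stub `stub_symNearCovLaw : SymNearCovLawSigR` (`Theorems/ForcedResponseSkewnessResponseLocalisationSmearedDefs.lean`)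
asks, for EVERY femto cube `Q`, EVERY exterior and EVERY deep site `z`, for reference values `n_β(w)` with
`|Σ_w φ(a β‖w‖)(kerCov_η^{Q}(dens (z+w), dens z) − n_β(w))| ≤ κ/depth(z)⁴`.  Here:

* `symNearCovLaw_of_centredOsc` — for a unit map `0 < a β → 0` with the frozen-boundary law `FBL G r a` (the line's
  other stub: `fbl_of_fbl6 ∘ stub_fbl6Pinned`), `SymNearCovLaw G r a` follows from the ONE-PARAMETER, REFERENCE-FREE
  statement: for `β ≥ β₂`, every radius `N` (`(2N+1)·a β ≤ ℓ₂`, `R/a β + 2 ≤ N+1`, `d₀ ≤ a β·(N+1)`), every PAIR of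
  exteriors `η, η'` of the centred cube `[-N, N]⁴`, every finite `B ⊇` lattice `R/a β`-ball and every radial profile
  `|φ| ≤ 1` vanishing on `[R, ∞)`:
  `|Σ_{w∈B} φ(a β‖w‖)·(kerCov_η^{[-N,N]⁴}(dens w, dens 0) − kerCov_{η'}^{[-N,N]⁴}(dens w, dens 0))| ≤ κ/(N+1)⁴`;
* `symNearCovLawSigR_of_centredOsc` — the same along a pinned unit (`FBLPinnedSigR` + the pinned oscillation law ⇒
  `SymNearCovLawSigR`, the registered stub statement BY NAME).

Mechanism (toolkit docstring): the centred cube `Q'` of radius `depth − 1` around `z` fits in `Q`; the law of total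
covariance through `Q'` (twice: in `Q`, and in the largest admissible centred cube `Q₀` with the unit exterior, whose
covariances are the reference values) costs the covariance of the `Q'`-kernel MEANS, second order in `FBL` and summed
over the `≤ (2R/a β+1)⁴` points of the ball — absorbed by shrinking the cut `R ≤ t·d₀` and `a β ≤ t·d₀`,
`t = min(1/2, κ/(20736 (C₁²+1)))`; translation covariance moves `Q'` to the origin, where the oscillation law compares
any two exteriors.  So the engine target of the line's AF stub is a statement about ONE family of cubes, at the centre,
with no reference values — exactly what a multi-scale expansion in a cube with prescribed exterior compares.

No summit is proved by any of this (leaf R2a `BalabanLadder.NT`, conditional rung line; the oscillation law itself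
(asymptotic freedom at one loop, resummed, uniformly in the exterior — Bałaban-class, not in print: Bałaban 1989,
CMP 122, p. 356 announces observables only; Magnen–Rivasseau–Sénéor 1993, CMP 155, pp. 325–326), the crux, NT and the
YM mass gap are NOT proved).
-/

set_option autoImplicit false

noncomputable section

open MeasureTheory Filter Topology
open Literature.MathematicalPhysics.QuantumFieldTheory Literature.MathematicalPhysics.QuantumLattice
open Literature.Probability.LatticeModels
open Summit.QuantumFields.YangMills.Cruxes.OSLegsFromFemtoAndGap.DlrCollarTransfer
open Summit.QuantumFields.YangMills.Cruxes.NT.BoundaryLaw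
open Summit.QuantumFields.YangMills.Cruxes.ResponseLocalisation.Birth

namespace Summit.QuantumFields.YangMills.Cruxes.ResponseLocalisation.CentredOsc
/-! ## The reduction -/

section Reduction

variable (G : Type) [Group G] [TopologicalSpace G] [IsTopologicalGroup G] [CompactSpace G]
  [MeasurableSpace G] [BorelSpace G] (r : LatticeRep G)

/-- **`SymNearCovLaw` from the frozen-boundary law and a CENTRED, REFERENCE-FREE oscillation law.**  For a unit map
`0 < a β → 0` with `FBL G r a`: if for some femto scale `ℓ₂` and every `κ > 0`, `d₀ ∈ (0, ℓ₂]` there are a cut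
`R ∈ (0, d₀]` and a threshold `β₂` such that for `β ≥ β₂`, every radius `N` with `(2N+1)·a β ≤ ℓ₂`,
`R/a β + 2 ≤ N+1`, `d₀ ≤ a β·(N+1)`, every two exteriors `η, η'` of the centred cube `[-N, N]⁴`, every finite `B`
containing the lattice `R/a β`-ball and every radial profile `|φ| ≤ 1` vanishing on `[R, ∞)` the signed radial sums
`Σ_{w∈B} φ(a β‖w‖)·kerCov^{[-N,N]⁴}(dens w, dens 0)` under `η` and `η'` differ by at most `κ/(N+1)⁴`, then the
registered AF law `SymNearCovLaw G r a` holds (with femto scale `min ℓ₂ ℓ₁`, `ℓ₁` from `FBL`).  Proof: module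
docstring (law of total covariance through the centred sub-cube of radius `depth − 1`, twice; the covariance of
the kernel means is second order in the boundary law and is absorbed by shrinking the cut). [folklore] -/
theorem symNearCovLaw_of_centredOsc (a : ℝ → ℝ) (ha : ∀ β, 0 < a β) (hlim : Tendsto a atTop (𝓝 0))
    (hFBL : FBL G r a)
    (hosc : ∃ ℓ₂ : ℝ, 0 < ℓ₂ ∧ ∀ κ : ℝ, 0 < κ → ∀ d₀ : ℝ, 0 < d₀ → d₀ ≤ ℓ₂ →
      ∃ R : ℝ, 0 < R ∧ R ≤ d₀ ∧ ∃ β₂ : ℝ, ∀ β : ℝ, β₂ ≤ β → ∀ N : ℕ, ((2 * N + 1 : ℕ) : ℝ) * a β ≤ ℓ₂ →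
        R / a β + 2 ≤ (N : ℝ) + 1 → d₀ ≤ a β * ((N : ℝ) + 1) →
        ∀ (η η' : LGConfig 4 G) (B : Finset (Fin 4 → ℤ)),
          (∀ w : Fin 4 → ℤ, a β * ‖siteToE w‖ < R → w ∈ B) →
          ∀ φ : ℝ → ℝ, (∀ t, |φ t| ≤ 1) → (∀ t, R ≤ t → φ t = 0) →
            |∑ w ∈ B, φ (a β * ‖siteToE w‖) *
                (kerCov G r β (fun _ => -(N : ℤ)) (2 * N + 1) η (dens G r w) (dens G r 0) -
                  kerCov G r β (fun _ => -(N : ℤ)) (2 * N + 1) η' (dens G r w) (dens G r 0))| ≤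
              κ / ((N : ℝ) + 1) ^ 4) :
    SymNearCovLaw G r a := by
  obtain ⟨ℓ₂, hℓ₂, H⟩ := hosc
  obtain ⟨C₁, β₁, ℓ₁, p, hℓ₁, hC₁, hF⟩ := hFBL
  refine ⟨min ℓ₂ ℓ₁, lt_min hℓ₂ hℓ₁, fun κ hκ d₀ hd₀ hd₀ℓ => ?_⟩
  -- the smallness parameter `t`, the cut `R`, the thresholds
  set t : ℝ := min (1 / 2) (κ / (20736 * (C₁ ^ 2 + 1))) with ht_def
  have ht0 : 0 < t := lt_min (by norm_num) (by positivity)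
  have ht1 : t ≤ 1 / 2 := min_le_left _ _
  have htκ : t ≤ κ / (20736 * (C₁ ^ 2 + 1)) := min_le_right _ _
  have htd₀ : t * d₀ ≤ d₀ := by nlinarith
  obtain ⟨R, hR0, hRle, β₂, HR⟩ := H (κ / 4) (by positivity) (t * d₀) (by positivity)
    (htd₀.trans (hd₀ℓ.trans (min_le_left _ _)))
  obtain ⟨βa, hβa⟩ : ∃ βa : ℝ, ∀ β, βa ≤ β → a β ≤ t * d₀ := by
    have hev : ∀ᶠ β in atTop, a β < t * d₀ := (tendsto_order.1 hlim).2 _ (by positivity)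
    obtain ⟨βa, hβa⟩ := eventually_atTop.1 hev
    exact ⟨βa, fun β hβ => (hβa β hβ).le⟩
  -- the reference values: unit-exterior covariances of the largest admissible centred cube `[-N₀, N₀]⁴`
  refine ⟨R, hR0, hRle.trans htd₀, max (max β₂ β₁) βa,
    fun β w => kerCov G r β (fun _ => -(⌊(min ℓ₂ ℓ₁ / a β - 1) / 2⌋₊ : ℤ))
      (2 * ⌊(min ℓ₂ ℓ₁ / a β - 1) / 2⌋₊ + 1) (fun _ => 1) (dens G r w) (dens G r 0), ?_⟩
  intro β hβ c b hb η z B hB hdR hdd φ hφ1 hφR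
  have hβ₂ : β₂ ≤ β := le_trans (le_trans (le_max_left _ _) (le_max_left _ _)) hβ
  have hβ₁ : β₁ ≤ β := le_trans (le_trans (le_max_right _ _) (le_max_left _ _)) hβ
  have haβt : a β ≤ t * d₀ := hβa β (le_trans (le_max_right _ _) hβ)
  have haβ : 0 < a β := ha β
  set N₀ : ℕ := ⌊(min ℓ₂ ℓ₁ / a β - 1) / 2⌋₊ with hN₀_def
  set nβ : (Fin 4 → ℤ) → ℝ := fun w =>
    kerCov G r β (fun _ => -(N₀ : ℤ)) (2 * N₀ + 1) (fun _ => 1) (dens G r w) (dens G r 0) with hnβ_def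
  set ω : (Fin 4 → ℤ) → ℝ := fun w => φ (a β * ‖siteToE w‖) with hω_def
  show |∑ w ∈ B, ω w * (kerCov G r β c b η (dens G r (z + w)) (dens G r z) - nβ w)| ≤
    κ / ((depth c b z : ℕ) : ℝ) ^ 4
  -- the depth `D = N + 1` and the centred sub-cube `Q'` of radius `N` around `z`
  have hRa : 0 < R / a β := div_pos hR0 haβ
  obtain ⟨N, hN⟩ : ∃ N : ℕ, depth c b z = N + 1 :=
    ⟨depth c b z - 1, by
      have h1 : (1 : ℝ) ≤ (depth c b z : ℝ) := by linarith
      have h2 : 1 ≤ depth c b z := by exact_mod_cast h1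
      omega⟩
  have hDN : ((depth c b z : ℕ) : ℝ) = (N : ℝ) + 1 := by rw [hN]; push_cast; ring
  rw [hDN] at hdR hdd ⊢
  set D : ℝ := (N : ℝ) + 1 with hD_def
  have hD0 : 0 < D := by positivity
  have hyN : N + 1 ≤ depth c b z := hN.ge
  have hsub : cubeEdges (fun j => z j - N) (2 * N + 1) ⊆ cubeEdges c b :=
    cubeEdges_subset (centredCube_subset_of_le_depth hyN)
  have h2N1 : 2 * N + 1 ≤ b := two_mul_add_one_le_of_le_depth hyN
  have hside : ((2 * N + 1 : ℕ) : ℝ) * a β ≤ min ℓ₂ ℓ₁ :=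
    (mul_le_mul_of_nonneg_right (by exact_mod_cast h2N1) haβ.le).trans hb
  have hsideℓ₂ : ((2 * N + 1 : ℕ) : ℝ) * a β ≤ ℓ₂ := hside.trans (min_le_left _ _)
  have hsideℓ₁ : ((2 * N + 1 : ℕ) : ℝ) * a β ≤ ℓ₁ := hside.trans (min_le_right _ _)
  -- the largest admissible radius `N₀ ≥ N`
  obtain ⟨hNN₀, hN₀side⟩ := floor_radius_admissible haβ hside
  have hN₀sideℓ₁ : ((2 * N₀ + 1 : ℕ) : ℝ) * a β ≤ ℓ₁ := hN₀side.trans (min_le_right _ _)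
  have hsub₀ : cubeEdges (fun _ => -(N : ℤ)) (2 * N + 1) ⊆ cubeEdges (fun _ => -(N₀ : ℤ)) (2 * N₀ + 1) :=
    cubeEdges_centred_subset hNN₀
  -- key inequalities between `R/aβ`, `t`, `D`
  have hd₀D : d₀ / a β ≤ D := by rw [div_le_iff₀ haβ]; linarith [hdd]
  have hRtD : R / a β ≤ t * D := by
    have h1 : R / a β ≤ t * d₀ / a β := div_le_div_of_nonneg_right hRle haβ.le
    have h2 : t * d₀ / a β = t * (d₀ / a β) := by ring
    rw [h2] at h1
    exact h1.trans (mul_le_mul_of_nonneg_left hd₀D ht0.le)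
  have htD1 : 1 ≤ t * D := by
    have h1 : 1 ≤ t * d₀ / a β := by rw [le_div_iff₀ haβ]; linarith
    have h2 : t * d₀ / a β = t * (d₀ / a β) := by ring
    rw [h2] at h1
    exact h1.trans (mul_le_mul_of_nonneg_left hd₀D ht0.le)
  have hRD2 : R / a β ≤ D / 2 := by nlinarith
  -- a weighted `w` lies in the `R/aβ`-ball
  have hball : ∀ w : Fin 4 → ℤ, ω w ≠ 0 → ‖siteToE w‖ < R / a β := by
    intro w hw
    by_contra hge
    push Not at hge
    have : R ≤ a β * ‖siteToE w‖ := by rw [div_le_iff₀ haβ] at hge; linarith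
    exact hw (hφR _ this)
  -- the boundary laws (FBL) in the centred cubes `Q'` (around `z`) and `Q''` (around `0`), radius `N`
  have hpow : ∀ {d : ℝ}, D / 2 ≤ d → C₁ / d ^ 4 ≤ C₁ / (D / 2) ^ 4 := fun {d} hd =>
    div_le_div_of_nonneg_left hC₁ (by positivity) (pow_le_pow_left₀ (by positivity) hd 4)
  have hpow' : ∀ {d : ℝ}, D ≤ d → C₁ / d ^ 4 ≤ C₁ / D ^ 4 := fun {d} hd =>
    div_le_div_of_nonneg_left hC₁ (by positivity) (pow_le_pow_left₀ hD0.le hd 4)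
  have hc0 : (fun j => (0 : Fin 4 → ℤ) j - (N : ℤ)) = fun _ => -(N : ℤ) := by funext j; simp
  -- centre `z` of `Q'`
  have hz : ∀ ξ : LGConfig 4 G, |kerE G r β (fun j => z j - N) (2 * N + 1) ξ (dens G r z) - p β| ≤ C₁ / D ^ 4 := by
    intro ξ
    have hdep : D ≤ (depth (fun j => z j - N) (2 * N + 1) z : ℝ) := le_depth_centre z N
    have h2 : 2 ≤ depth (fun j => z j - N) (2 * N + 1) z := by
      have : (2 : ℝ) ≤ (depth (fun j => z j - N) (2 * N + 1) z : ℝ) := by linarith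
      exact_mod_cast this
    exact (hF β hβ₁ _ _ hsideℓ₁ ξ z h2).trans (hpow' hdep)
  -- near sites `z + w` of `Q'`
  have hw : ∀ w ∈ B, ω w ≠ 0 → ∀ ξ : LGConfig 4 G,
      |kerE G r β (fun j => z j - N) (2 * N + 1) ξ (dens G r (z + w)) - p β| ≤ C₁ / (D / 2) ^ 4 := by
    intro w _ hw0 ξ
    have hwn := (hball w hw0).le
    have hdep : D / 2 ≤ (depth (fun j => z j - N) (2 * N + 1) (z + w) : ℝ) := by
      have := le_depth_centred_of_norm_le z w N hwn
      linarith
    have h2 : 2 ≤ depth (fun j => z j - N) (2 * N + 1) (z + w) := by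
      have h3 := le_depth_centred_of_norm_le z w N hwn
      have : (2 : ℝ) ≤ (depth (fun j => z j - N) (2 * N + 1) (z + w) : ℝ) := by linarith
      exact_mod_cast this
    exact (hF β hβ₁ _ _ hsideℓ₁ ξ (z + w) h2).trans (hpow hdep)
  -- centre `0` of `Q''`
  have hz0 : ∀ ξ : LGConfig 4 G, |kerE G r β (fun _ => -(N : ℤ)) (2 * N + 1) ξ (dens G r 0) - p β| ≤ C₁ / D ^ 4 := by
    intro ξ
    have hdep : D ≤ (depth (fun _ => -(N : ℤ)) (2 * N + 1) 0 : ℝ) := by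
      have := le_depth_centre (0 : Fin 4 → ℤ) N
      rwa [hc0] at this
    have h2 : 2 ≤ depth (fun _ => -(N : ℤ)) (2 * N + 1) 0 := by
      have : (2 : ℝ) ≤ (depth (fun _ => -(N : ℤ)) (2 * N + 1) 0 : ℝ) := by linarith
      exact_mod_cast this
    exact (hF β hβ₁ _ _ hsideℓ₁ ξ 0 h2).trans (hpow' hdep)
  -- near sites `w` of `Q''`
  have hw0 : ∀ w ∈ B, ω w ≠ 0 → ∀ ξ : LGConfig 4 G,
      |kerE G r β (fun _ => -(N : ℤ)) (2 * N + 1) ξ (dens G r (0 + w)) - p β| ≤ C₁ / (D / 2) ^ 4 := by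
    intro w _ hw0' ξ
    have hwn := (hball w hw0').le
    have h3 : (N : ℝ) + 1 - R / a β ≤ (depth (fun _ => -(N : ℤ)) (2 * N + 1) (0 + w) : ℝ) := by
      have := le_depth_centred_of_norm_le (0 : Fin 4 → ℤ) w N hwn
      rwa [hc0] at this
    have hdep : D / 2 ≤ (depth (fun _ => -(N : ℤ)) (2 * N + 1) (0 + w) : ℝ) := by linarith
    have h2 : 2 ≤ depth (fun _ => -(N : ℤ)) (2 * N + 1) (0 + w) := by
      have : (2 : ℝ) ≤ (depth (fun _ => -(N : ℤ)) (2 * N + 1) (0 + w) : ℝ) := by linarith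
      exact_mod_cast this
    exact (hF β hβ₁ _ _ hsideℓ₁ ξ (0 + w) h2).trans (hpow hdep)
  -- Step A: total covariance in `Q ⊇ Q'`
  have hA := abs_wsum_kerCov_sub_kerE_le G r β hsub η z B ω nβ hz hw
  -- Step B: total covariance in `Q₀ ⊇ Q''` (unit exterior); the reference sum vanishes identically
  have hB0 := abs_wsum_kerCov_sub_kerE_le G r β hsub₀ (fun _ => 1) 0 B ω nβ hz0 hw0
  simp only [zero_add] at hB0
  have hvan : ∑ w ∈ B, ω w * (kerCov G r β (fun _ => -(N₀ : ℤ)) (2 * N₀ + 1) (fun _ => 1)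
      (dens G r w) (dens G r 0) - nβ w) = 0 := by
    refine Finset.sum_eq_zero fun w _ => ?_
    rw [hnβ_def]
    ring
  rw [hvan, zero_sub, abs_neg] at hB0
  -- Step C: the oscillation law in `Q''`
  set G₂ : LGConfig 4 G → ℝ := fun ξ => ∑ w ∈ B, ω w *
    (kerCov G r β (fun _ => -(N : ℤ)) (2 * N + 1) ξ (dens G r w) (dens G r 0) - nβ w) with hG₂_def
  have hdR' : R / a β + 2 ≤ (N : ℝ) + 1 := hdR
  have hdd' : t * d₀ ≤ a β * ((N : ℝ) + 1) := htd₀.trans hdd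
  have hoscN : ∀ ξ₁ ξ₂ : LGConfig 4 G, |G₂ ξ₁ - G₂ ξ₂| ≤ κ / 4 / D ^ 4 := by
    intro ξ₁ ξ₂
    have e : G₂ ξ₁ - G₂ ξ₂ = ∑ w ∈ B, ω w *
        (kerCov G r β (fun _ => -(N : ℤ)) (2 * N + 1) ξ₁ (dens G r w) (dens G r 0) -
          kerCov G r β (fun _ => -(N : ℤ)) (2 * N + 1) ξ₂ (dens G r w) (dens G r 0)) := by
      rw [hG₂_def, ← Finset.sum_sub_distrib]
      exact Finset.sum_congr rfl fun w _ => by ring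
    rw [e]
    exact HR β hβ₂ N hsideℓ₂ hdR' hdd' ξ₁ ξ₂ B hB φ hφ1 hφR
  -- continuity of the inner sums
  have hG₂c : Continuous G₂ :=
    continuous_finsetSum B fun w _ =>
      continuous_const.mul ((continuous_kerCov_dens G r β _ _ w 0).sub continuous_const)
  have hG₁c : Continuous fun ξ : LGConfig 4 G => ∑ w ∈ B, ω w *
      (kerCov G r β (fun j => z j - N) (2 * N + 1) ξ (dens G r (z + w)) (dens G r z) - nβ w) :=
    continuous_finsetSum B fun w _ =>
      continuous_const.mul ((continuous_kerCov_dens G r β _ _ (z + w) z).sub continuous_const)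
  -- Step D: both kernel averages are within `κ/4D⁴` of `G₂ ξ₀`
  set ξ₀ : LGConfig 4 G := fun _ => 1 with hξ₀_def
  have hG₁G₂ : ∀ ξ : LGConfig 4 G, (∑ w ∈ B, ω w *
      (kerCov G r β (fun j => z j - N) (2 * N + 1) ξ (dens G r (z + w)) (dens G r z) - nβ w)) =
      G₂ (configShift (-z) ξ) := by
    intro ξ
    rw [hG₂_def]
    exact Finset.sum_congr rfl fun w _ => by rw [kerCov_dens_centred_eq]
  have hE1 : |kerE G r β c b η (fun ξ => ∑ w ∈ B, ω w *
      (kerCov G r β (fun j => z j - N) (2 * N + 1) ξ (dens G r (z + w)) (dens G r z) - nβ w)) - G₂ ξ₀|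
      ≤ κ / 4 / D ^ 4 :=
    abs_kerE_sub_le_of_forall G r β c b η hG₁c fun ξ => by rw [hG₁G₂]; exact hoscN _ _
  have hE2 : |kerE G r β (fun _ => -(N₀ : ℤ)) (2 * N₀ + 1) (fun _ => 1) G₂ - G₂ ξ₀| ≤ κ / 4 / D ^ 4 :=
    abs_kerE_sub_le_of_forall G r β _ _ _ hG₂c fun ξ => hoscN _ _
  -- the second-order remainder is `≤ κ/4D⁴`
  have hWsum : ∑ w ∈ B, |ω w| ≤ (2 * (R / a β) + 1) ^ 4 := sum_abs_weight_le B haβ hR0.le φ hφ1 hφR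
  have hX0 : (0 : ℝ) ≤ 2 * (R / a β) + 1 := by positivity
  have hX : 2 * (R / a β) + 1 ≤ 3 * t * D := by linarith
  have e16 : C₁ / (D / 2) ^ 4 = 16 * C₁ / D ^ 4 := by
    field_simp
    ring
  have hrem : (∑ w ∈ B, |ω w|) * (4 * (C₁ / (D / 2) ^ 4) * (C₁ / D ^ 4)) ≤ κ / 4 / D ^ 4 := by
    rw [e16]
    have hnn : 0 ≤ 4 * (16 * C₁ / D ^ 4) * (C₁ / D ^ 4) := by positivity
    exact (mul_le_mul_of_nonneg_right hWsum hnn).trans (remainder_le hκ ht0 ht1 htκ hD0 hX0 hX)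
  -- assemble
  have hfin : κ / 4 / D ^ 4 + κ / 4 / D ^ 4 + κ / 4 / D ^ 4 + κ / 4 / D ^ 4 = κ / D ^ 4 := by ring
  rw [hG₂_def] at hE2 hB0
  calc |∑ w ∈ B, ω w * (kerCov G r β c b η (dens G r (z + w)) (dens G r z) - nβ w)|
      ≤ |∑ w ∈ B, ω w * (kerCov G r β c b η (dens G r (z + w)) (dens G r z) - nβ w) -
            kerE G r β c b η (fun ξ => ∑ w ∈ B, ω w *
              (kerCov G r β (fun j => z j - N) (2 * N + 1) ξ (dens G r (z + w)) (dens G r z) - nβ w))|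
        + |kerE G r β c b η (fun ξ => ∑ w ∈ B, ω w *
              (kerCov G r β (fun j => z j - N) (2 * N + 1) ξ (dens G r (z + w)) (dens G r z) - nβ w)) - G₂ ξ₀|
        + |kerE G r β (fun _ => -(N₀ : ℤ)) (2 * N₀ + 1) (fun _ => 1) G₂ - G₂ ξ₀|
        + |kerE G r β (fun _ => -(N₀ : ℤ)) (2 * N₀ + 1) (fun _ => 1) G₂| := by
          have h1 := abs_sub_abs_le_abs_sub
            (∑ w ∈ B, ω w * (kerCov G r β c b η (dens G r (z + w)) (dens G r z) - nβ w))
            (kerE G r β c b η (fun ξ => ∑ w ∈ B, ω w *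
              (kerCov G r β (fun j => z j - N) (2 * N + 1) ξ (dens G r (z + w)) (dens G r z) - nβ w)))
          have h2 := abs_sub_abs_le_abs_sub
            (kerE G r β c b η (fun ξ => ∑ w ∈ B, ω w *
              (kerCov G r β (fun j => z j - N) (2 * N + 1) ξ (dens G r (z + w)) (dens G r z) - nβ w)))
            (G₂ ξ₀)
          have h3 := abs_sub_abs_le_abs_sub (G₂ ξ₀)
            (kerE G r β (fun _ => -(N₀ : ℤ)) (2 * N₀ + 1) (fun _ => 1) G₂)
          rw [abs_sub_comm (G₂ ξ₀)] at h3
          linarith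
    _ ≤ κ / 4 / D ^ 4 + κ / 4 / D ^ 4 + κ / 4 / D ^ 4 + κ / 4 / D ^ 4 := by
          gcongr
          · exact hA.trans hrem
          · exact hB0.trans hrem
    _ = κ / D ^ 4 := hfin

/-- **Pinned form**: along a unit pinned by a compactly supported positive-time floor witness, the frozen-boundary law
`FBLPinnedSigR` (the tree's `fblPinnedSigR_of_fbl6 ∘ stub_fbl6Pinned`) and the centred reference-free oscillation law
give the registered AF stub statement `SymNearCovLawSigR`. [folklore] -/
theorem symNearCovLawSigR_of_centredOsc (hFBL : FBLPinnedSigR)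
    (hosc : ∀ (G : Type) [Group G] [TopologicalSpace G] [IsTopologicalGroup G] [CompactSpace G],
      IsCompactSimpleLieGroup G →
      letI : MeasurableSpace G := borel G
      haveI : BorelSpace G := ⟨rfl⟩
      ∀ (r : LatticeRep G) (a : ℝ → ℝ), (∀ β, 0 < a β) → Filter.Tendsto a Filter.atTop (nhds 0) →
        (∃ (v₀ : SchwartzMap (EuclideanSpace ℝ (Fin 4)) ℝ) (ε β₅ Λ₅ : ℝ), HasCompactSupport v₀ ∧
          tsupport v₀ ⊆ {y : EuclideanSpace ℝ (Fin 4) | 0 < y 0} ∧ 0 < ε ∧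
          ∀ β : ℝ, β₅ ≤ β → ∀ L : ℕ, Λ₅ ≤ a β * L → ε ≤ Q2 G r β L (a β) (thetaTest 4 v₀) v₀) →
        ∃ ℓ₂ : ℝ, 0 < ℓ₂ ∧ ∀ κ : ℝ, 0 < κ → ∀ d₀ : ℝ, 0 < d₀ → d₀ ≤ ℓ₂ →
          ∃ R : ℝ, 0 < R ∧ R ≤ d₀ ∧ ∃ β₂ : ℝ, ∀ β : ℝ, β₂ ≤ β → ∀ N : ℕ, ((2 * N + 1 : ℕ) : ℝ) * a β ≤ ℓ₂ →
            R / a β + 2 ≤ (N : ℝ) + 1 → d₀ ≤ a β * ((N : ℝ) + 1) →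
            ∀ (η η' : LGConfig 4 G) (B : Finset (Fin 4 → ℤ)),
              (∀ w : Fin 4 → ℤ, a β * ‖siteToE w‖ < R → w ∈ B) →
              ∀ φ : ℝ → ℝ, (∀ t, |φ t| ≤ 1) → (∀ t, R ≤ t → φ t = 0) →
                |∑ w ∈ B, φ (a β * ‖siteToE w‖) *
                    (kerCov G r β (fun _ => -(N : ℤ)) (2 * N + 1) η (dens G r w) (dens G r 0) -
                      kerCov G r β (fun _ => -(N : ℤ)) (2 * N + 1) η' (dens G r w) (dens G r 0))| ≤
                  κ / ((N : ℝ) + 1) ^ 4) :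
    SymNearCovLawSigR := by
  intro G _ _ _ _ hG
  letI : MeasurableSpace G := borel G
  haveI : BorelSpace G := ⟨rfl⟩
  intro r a ha hlim hpin
  exact symNearCovLaw_of_centredOsc G r a ha hlim (hFBL G hG r a ha hlim hpin) (hosc G hG r a ha hlim hpin)

end Reduction

end Summit.QuantumFields.YangMills.Cruxes.ResponseLocalisation.CentredOsc

end
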